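import Mathlib.MeasureTheory.Integral.Pi
import Mathlib.Analysis.SpecialFunctions.Pow.Continuity
import Mathlib.Analysis.SpecialFunctions.Integrability.Basic
import Literature.NumberTheory.Transcendental.KZCalculusProofs
import Literature.NumberTheory.Transcendental.KZCubeProducts
import Literature.Analysis.SpecialFunctions.SelbergIntegralBasic

/-!
# Terasoma multiplication, complete mod-`Γ` sector: integrability of the Elliott divergence pieces

Engine client E-L4 of the cusp transport `ElliottToCusp`: the two divergence pieces
`g₁ = ∂ₜP` and `g₂ = ∂ᵤQ` of the Elliott certificate,

* `g₁(t,u,s) = K · u · [(1-2t) - a(1-t) - (c+a-2)t + a s t(1-t)/(1-st)]`,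
* `g₂(t,u,s) = -K · t · [(1-2u) - a(1-u) - (c+a-2)u + a(1-s)u(1-u)/(1-(1-s)u)]`,

with the kernel `K(t,u,s) = t^{-a}(1-t)^{c+a-2}(1-st)^{-a} u^{-a}(1-u)^{c+a-2}(1-(1-s)u)^{-a}`, are
absolutely integrable on the open band `(0,1)² × (0,z₁)` for `0 < a < 1`, `1 - a < c`, `0 < z₁ < 1`.

Proof: on the band `1 - st ≥ 1 - z₁` and `1 - (1-s)u ≥ s`, so `(1-st)^{-a} ≤ (1-z₁)^{-a}` and
`(1-(1-s)u)^{-a} ≤ s^{-a}`; the brackets are bounded by `2 + |c| + 1/(1-z₁)`. Hence both pieces are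
dominated by `C · [t^{-a}(1-t)^{c+a-2}] · [u^{-a}(1-u)^{c+a-2}] · s^{-a}`, a product of one-variable
Beta kernels, integrable on the unit cube by Tonelli (`MeasureTheory.Integrable.fintype_prod`);
the pieces are continuous on the open band, so `MeasureTheory.Integrable.mono'` concludes.
Elementary real analysis; everything is proved, no `def`, no named fact.
-/

noncomputable section
set_option linter.dupNamespace false

namespace Summit.KontsevichZagierPeriods.KontsevichZagierPeriods.CompleteModGammaSectorEngine

open MeasureTheory Set
open Literature.NumberTheory.Transcendental
open Literature.NumberTheory.Transcendental.KZ

/-! ## Pure algebra: the domination pattern -/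

/-- The domination pattern `|A·Bt·Ct·Au·Bu·Cu·v·br| ≤ E·L·(A·Bt·(Au·Bu)·S)` for nonnegative factors
with `Ct ≤ L`, `Cu ≤ S`, `0 ≤ v ≤ 1`, `|br| ≤ E`. [folklore] -/
theorem ellInt_abs_kernel_mul_le {A Bt Ct Au Bu Cu L S v br E : ℝ}
    (hA : 0 ≤ A) (hBt : 0 ≤ Bt) (hCt : 0 ≤ Ct) (hAu : 0 ≤ Au) (hBu : 0 ≤ Bu) (hCu : 0 ≤ Cu)
    (hL : Ct ≤ L) (hS : Cu ≤ S) (hv0 : 0 ≤ v) (hv : v ≤ 1) (hbr : |br| ≤ E) :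
    |A * Bt * Ct * Au * Bu * Cu * v * br| ≤ E * L * (A * Bt * (Au * Bu) * S) := by
  have hE : 0 ≤ E := (abs_nonneg _).trans hbr
  have hL0 : 0 ≤ L := hCt.trans hL
  have hS0 : 0 ≤ S := hCu.trans hS
  rw [abs_mul, abs_of_nonneg (by positivity : 0 ≤ A * Bt * Ct * Au * Bu * Cu * v)]
  calc A * Bt * Ct * Au * Bu * Cu * v * |br|
      = (A * Bt * (Au * Bu)) * (Ct * (Cu * (v * |br|))) := by ring
    _ ≤ (A * Bt * (Au * Bu)) * (L * (S * (1 * E))) := by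
        apply mul_le_mul_of_nonneg_left _ (by positivity)
        apply mul_le_mul hL _ (by positivity) hL0
        apply mul_le_mul hS _ (by positivity) hS0
        exact mul_le_mul hv hbr (abs_nonneg _) zero_le_one
    _ = E * L * (A * Bt * (Au * Bu) * S) := by ring

/-! ## Pointwise bounds on the band -/

/-- Bound for the first divergence piece `g₁ = ∂ₜP` on the band: `|g₁| ≤ C·φ(t)φ(u)s^{-a}` with
`φ(x) = x^{-a}(1-x)^{c+a-2}`, `C = (2 + |c| + 1/(1-z₁))(1-z₁)^{-a}`. [folklore] -/
theorem ellInt_abs_g₁_le {α γ z₁ t u s : ℝ} (hα0 : 0 < α) (hα1 : α < 1) (hz1 : z₁ < 1)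
    (ht : t ∈ Ioo (0:ℝ) 1) (hu : u ∈ Ioo (0:ℝ) 1) (hs : s ∈ Ioo 0 z₁) :
    |(t ^ (-α) * (1 - t) ^ (γ + α - 2) * (1 - s * t) ^ (-α) * u ^ (-α) * (1 - u) ^ (γ + α - 2) *
        (1 - (1 - s) * u) ^ (-α)) * u *
      ((1 - 2 * t) - α * (1 - t) - (γ + α - 2) * t + α * s * t * (1 - t) / (1 - s * t))| ≤
    (2 + |γ| + 1 / (1 - z₁)) * (1 - z₁) ^ (-α) *
      ((t ^ (-α) * (1 - t) ^ (γ + α - 2)) * (u ^ (-α) * (1 - u) ^ (γ + α - 2)) * s ^ (-α)) := by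
  obtain ⟨ht0, ht1⟩ := ht
  obtain ⟨hu0, hu1⟩ := hu
  obtain ⟨hs0, hs1⟩ := hs
  have hst : s * t ≤ s := mul_le_of_le_one_right hs0.le ht1.le
  have hden : 0 < 1 - s * t := by linarith
  have hden' : 1 - z₁ ≤ 1 - s * t := by linarith
  have hz : 0 < 1 - z₁ := by linarith
  have hsu : s ≤ 1 - (1 - s) * u := by nlinarith [mul_nonneg (sub_nonneg.2 (hs1.trans hz1).le) (sub_nonneg.2 hu1.le)]
  -- the bracket
  have hγt : |γ * t| ≤ |γ| := by
    rw [abs_mul, abs_of_pos ht0]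
    exact mul_le_of_le_one_right (abs_nonneg γ) ht1.le
  have hq0 : 0 ≤ α * s * t * (1 - t) / (1 - s * t) :=
    div_nonneg (mul_nonneg (mul_nonneg (mul_nonneg hα0.le hs0.le) ht0.le) (sub_nonneg.2 ht1.le))
      hden.le
  have hnum : α * s * t * (1 - t) ≤ 1 :=
    mul_le_one₀ (mul_le_one₀ (mul_le_one₀ hα1.le hs0.le (by linarith)) ht0.le ht1.le)
      (sub_nonneg.2 ht1.le) (by linarith)
  have hq1 : α * s * t * (1 - t) / (1 - s * t) ≤ 1 / (1 - z₁) := div_le_div₀ zero_le_one hnum hz hden'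
  have hD : 0 ≤ 1 / (1 - z₁) := div_nonneg zero_le_one hz.le
  have hbr : |(1 - 2 * t) - α * (1 - t) - (γ + α - 2) * t + α * s * t * (1 - t) / (1 - s * t)| ≤
      2 + |γ| + 1 / (1 - z₁) := by
    obtain ⟨hγ1, hγ2⟩ := abs_le.1 hγt
    rw [abs_le]
    constructor
    · nlinarith [abs_nonneg γ]
    · nlinarith [abs_nonneg γ]
  exact ellInt_abs_kernel_mul_le (Real.rpow_nonneg ht0.le _) (Real.rpow_nonneg (sub_nonneg.2 ht1.le) _)
    (Real.rpow_nonneg hden.le _) (Real.rpow_nonneg hu0.le _) (Real.rpow_nonneg (sub_nonneg.2 hu1.le) _)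
    (Real.rpow_nonneg (hs0.le.trans hsu) _)
    (Real.rpow_le_rpow_of_nonpos hz hden' (by linarith))
    (Real.rpow_le_rpow_of_nonpos hs0 hsu (by linarith)) hu0.le hu1.le hbr

/-- Bound for the second divergence piece `g₂ = ∂ᵤQ` on the band: `|g₂| ≤ C·φ(t)φ(u)s^{-a}` with
the same `φ` and `C` as for `g₁`. [folklore] -/
theorem ellInt_abs_g₂_le {α γ z₁ t u s : ℝ} (hα0 : 0 < α) (hα1 : α < 1) (hz1 : z₁ < 1)
    (ht : t ∈ Ioo (0:ℝ) 1) (hu : u ∈ Ioo (0:ℝ) 1) (hs : s ∈ Ioo 0 z₁) :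
    |(-((t ^ (-α) * (1 - t) ^ (γ + α - 2) * (1 - s * t) ^ (-α) * u ^ (-α) * (1 - u) ^ (γ + α - 2) *
        (1 - (1 - s) * u) ^ (-α)) * t *
      ((1 - 2 * u) - α * (1 - u) - (γ + α - 2) * u + α * (1 - s) * u * (1 - u) / (1 - (1 - s) * u))))| ≤
    (2 + |γ| + 1 / (1 - z₁)) * (1 - z₁) ^ (-α) *
      ((t ^ (-α) * (1 - t) ^ (γ + α - 2)) * (u ^ (-α) * (1 - u) ^ (γ + α - 2)) * s ^ (-α)) := by
  obtain ⟨ht0, ht1⟩ := ht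
  obtain ⟨hu0, hu1⟩ := hu
  obtain ⟨hs0, hs1⟩ := hs
  have hst : s * t ≤ s := mul_le_of_le_one_right hs0.le ht1.le
  have hden : 0 < 1 - s * t := by linarith
  have hden' : 1 - z₁ ≤ 1 - s * t := by linarith
  have hz : 0 < 1 - z₁ := by linarith
  have hs1' : s ≤ 1 := (hs1.trans hz1).le
  have hsu : s ≤ 1 - (1 - s) * u := by nlinarith [mul_nonneg (sub_nonneg.2 hs1') (sub_nonneg.2 hu1.le)]
  have hden2 : 0 < 1 - (1 - s) * u := hs0.trans_le hsu
  -- the bracket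
  have hγu : |γ * u| ≤ |γ| := by
    rw [abs_mul, abs_of_pos hu0]
    exact mul_le_of_le_one_right (abs_nonneg γ) hu1.le
  have hq0 : 0 ≤ α * (1 - s) * u * (1 - u) / (1 - (1 - s) * u) :=
    div_nonneg (mul_nonneg (mul_nonneg (mul_nonneg hα0.le (sub_nonneg.2 hs1')) hu0.le)
      (sub_nonneg.2 hu1.le)) hden2.le
  have hnum1 : α * (1 - s) * u ≤ 1 :=
    mul_le_one₀ (mul_le_one₀ hα1.le (sub_nonneg.2 hs1') (by linarith)) hu0.le hu1.le
  have hnum : α * (1 - s) * u * (1 - u) ≤ 1 - (1 - s) * u := by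
    have h1 : α * (1 - s) * u * (1 - u) ≤ 1 - u := by nlinarith
    nlinarith [mul_nonneg hs0.le hu0.le]
  have hq1 : α * (1 - s) * u * (1 - u) / (1 - (1 - s) * u) ≤ 1 := (div_le_one hden2).2 hnum
  have hD : 0 ≤ 1 / (1 - z₁) := div_nonneg zero_le_one hz.le
  have hbr : |(1 - 2 * u) - α * (1 - u) - (γ + α - 2) * u +
      α * (1 - s) * u * (1 - u) / (1 - (1 - s) * u)| ≤ 2 + |γ| + 1 / (1 - z₁) := by
    obtain ⟨hγ1, hγ2⟩ := abs_le.1 hγu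
    rw [abs_le]
    constructor
    · nlinarith [abs_nonneg γ]
    · nlinarith [abs_nonneg γ]
  rw [abs_neg]
  exact ellInt_abs_kernel_mul_le (Real.rpow_nonneg ht0.le _) (Real.rpow_nonneg (sub_nonneg.2 ht1.le) _)
    (Real.rpow_nonneg hden.le _) (Real.rpow_nonneg hu0.le _) (Real.rpow_nonneg (sub_nonneg.2 hu1.le) _)
    (Real.rpow_nonneg (hs0.le.trans hsu) _)
    (Real.rpow_le_rpow_of_nonpos hz hden' (by linarith))
    (Real.rpow_le_rpow_of_nonpos hs0 hsu (by linarith)) ht0.le ht1.le hbr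

/-! ## Continuity on the open band -/

/-- The Elliott kernel `K(t,u,s)` is continuous at every point where its six bases are nonzero.
[folklore] -/
theorem ellInt_continuousAt_kernel (α β : ℝ) {z : Fin 3 → ℝ} (ht : z 0 ≠ 0) (ht' : 1 - z 0 ≠ 0)
    (hst : 1 - z 2 * z 0 ≠ 0) (hu : z 1 ≠ 0) (hu' : 1 - z 1 ≠ 0) (hsu : 1 - (1 - z 2) * z 1 ≠ 0) :
    ContinuousAt (fun z : Fin 3 → ℝ => z 0 ^ (-α) * (1 - z 0) ^ β * (1 - z 2 * z 0) ^ (-α) *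
      z 1 ^ (-α) * (1 - z 1) ^ β * (1 - (1 - z 2) * z 1) ^ (-α)) z := by
  have h0 : ContinuousAt (fun z : Fin 3 → ℝ => z 0) z := (continuous_apply 0).continuousAt
  have h1 : ContinuousAt (fun z : Fin 3 → ℝ => z 1) z := (continuous_apply 1).continuousAt
  have h2 : ContinuousAt (fun z : Fin 3 → ℝ => z 2) z := (continuous_apply 2).continuousAt
  exact (((((h0.rpow_const (p := -α) (Or.inl ht)).mul
    ((continuousAt_const.sub h0).rpow_const (p := β) (Or.inl ht'))).mul
    ((continuousAt_const.sub (h2.mul h0)).rpow_const (p := -α) (Or.inl hst))).mul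
    (h1.rpow_const (p := -α) (Or.inl hu))).mul
    ((continuousAt_const.sub h1).rpow_const (p := β) (Or.inl hu'))).mul
    ((continuousAt_const.sub ((continuousAt_const.sub h2).mul h1)).rpow_const (p := -α) (Or.inl hsu))

/-- The first divergence piece `g₁` is continuous on the open band. [folklore] -/
theorem ellInt_continuousOn_g₁ (α γ z₁ : ℝ) (hz1 : z₁ < 1) :
    ContinuousOn (fun z : Fin 3 → ℝ => (z 0 ^ (-α) * (1 - z 0) ^ (γ + α - 2) *
      (1 - z 2 * z 0) ^ (-α) * z 1 ^ (-α) * (1 - z 1) ^ (γ + α - 2) * (1 - (1 - z 2) * z 1) ^ (-α)) *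
      z 1 * ((1 - 2 * z 0) - α * (1 - z 0) - (γ + α - 2) * z 0 +
        α * z 2 * z 0 * (1 - z 0) / (1 - z 2 * z 0)))
      {z : Fin 3 → ℝ | (∀ j : Fin 2, z (Fin.castSucc j) ∈ Set.Ioo (0:ℝ) 1) ∧
        z (Fin.last 2) ∈ Set.Ioo 0 z₁} := by
  intro z hz
  have ht : z 0 ∈ Ioo (0:ℝ) 1 := by simpa using hz.1 0
  have hu : z 1 ∈ Ioo (0:ℝ) 1 := by simpa using hz.1 1
  have hs : z 2 ∈ Ioo (0:ℝ) z₁ := by simpa using hz.2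
  have hst : z 2 * z 0 ≤ z 2 := mul_le_of_le_one_right hs.1.le ht.2.le
  have hden : 1 - z 2 * z 0 ≠ 0 := by nlinarith [hs.2]
  have hden2 : 1 - (1 - z 2) * z 1 ≠ 0 := by
    nlinarith [mul_nonneg (sub_nonneg.2 ((hs.2.trans hz1).le)) (sub_nonneg.2 hu.2.le), hs.1]
  have h0 : ContinuousAt (fun z : Fin 3 → ℝ => z 0) z := (continuous_apply 0).continuousAt
  have h1 : ContinuousAt (fun z : Fin 3 → ℝ => z 1) z := (continuous_apply 1).continuousAt
  have h2 : ContinuousAt (fun z : Fin 3 → ℝ => z 2) z := (continuous_apply 2).continuousAt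
  refine ContinuousAt.continuousWithinAt ?_
  refine ((ellInt_continuousAt_kernel α (γ + α - 2) ht.1.ne' (sub_pos.2 ht.2).ne' hden hu.1.ne'
    (sub_pos.2 hu.2).ne' hden2).mul h1).mul ?_
  exact (((continuousAt_const.sub (continuousAt_const.mul h0)).sub
    (continuousAt_const.mul (continuousAt_const.sub h0))).sub (continuousAt_const.mul h0)).add
    ((((continuousAt_const.mul h2).mul h0).mul (continuousAt_const.sub h0)).div₀
      (continuousAt_const.sub (h2.mul h0)) hden)

/-- The second divergence piece `g₂` is continuous on the open band. [folklore] -/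
theorem ellInt_continuousOn_g₂ (α γ z₁ : ℝ) (hz1 : z₁ < 1) :
    ContinuousOn (fun z : Fin 3 → ℝ => (-((z 0 ^ (-α) * (1 - z 0) ^ (γ + α - 2) *
      (1 - z 2 * z 0) ^ (-α) * z 1 ^ (-α) * (1 - z 1) ^ (γ + α - 2) * (1 - (1 - z 2) * z 1) ^ (-α)) *
      z 0 * ((1 - 2 * z 1) - α * (1 - z 1) - (γ + α - 2) * z 1 +
        α * (1 - z 2) * z 1 * (1 - z 1) / (1 - (1 - z 2) * z 1)))))
      {z : Fin 3 → ℝ | (∀ j : Fin 2, z (Fin.castSucc j) ∈ Set.Ioo (0:ℝ) 1) ∧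
        z (Fin.last 2) ∈ Set.Ioo 0 z₁} := by
  intro z hz
  have ht : z 0 ∈ Ioo (0:ℝ) 1 := by simpa using hz.1 0
  have hu : z 1 ∈ Ioo (0:ℝ) 1 := by simpa using hz.1 1
  have hs : z 2 ∈ Ioo (0:ℝ) z₁ := by simpa using hz.2
  have hst : z 2 * z 0 ≤ z 2 := mul_le_of_le_one_right hs.1.le ht.2.le
  have hden : 1 - z 2 * z 0 ≠ 0 := by nlinarith [hs.2]
  have hden2 : 1 - (1 - z 2) * z 1 ≠ 0 := by
    nlinarith [mul_nonneg (sub_nonneg.2 ((hs.2.trans hz1).le)) (sub_nonneg.2 hu.2.le), hs.1]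
  have h0 : ContinuousAt (fun z : Fin 3 → ℝ => z 0) z := (continuous_apply 0).continuousAt
  have h1 : ContinuousAt (fun z : Fin 3 → ℝ => z 1) z := (continuous_apply 1).continuousAt
  have h2 : ContinuousAt (fun z : Fin 3 → ℝ => z 2) z := (continuous_apply 2).continuousAt
  refine ContinuousAt.continuousWithinAt (ContinuousAt.neg ?_)
  refine ((ellInt_continuousAt_kernel α (γ + α - 2) ht.1.ne' (sub_pos.2 ht.2).ne' hden hu.1.ne'
    (sub_pos.2 hu.2).ne' hden2).mul h0).mul ?_
  exact (((continuousAt_const.sub (continuousAt_const.mul h1)).sub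
    (continuousAt_const.mul (continuousAt_const.sub h1))).sub (continuousAt_const.mul h1)).add
    ((((continuousAt_const.mul (continuousAt_const.sub h2)).mul h1).mul (continuousAt_const.sub h1)).div₀
      (continuousAt_const.sub ((continuousAt_const.sub h2).mul h1)) hden2)

/-! ## Domination on the band -/

/-- Domination principle on the band `(0,1)² × (0,z₁)`, `z₁ ≤ 1`: a function continuous on the band
and bounded there by `C·φ(t)φ(u)ψ(s)` with `φ, ψ ∈ L¹(0,1)` is integrable on the band (Tonelli on
the unit cube, `MeasureTheory.Integrable.fintype_prod`, and `MeasureTheory.Integrable.mono'`).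
[folklore] -/
theorem ellInt_integrableOn_band_of_abs_le {z₁ : ℝ} (C : ℝ) (hz1 : z₁ ≤ 1) {g : (Fin 3 → ℝ) → ℝ}
    {φ ψ : ℝ → ℝ} (hφ : IntegrableOn φ (Ioo (0:ℝ) 1)) (hψ : IntegrableOn ψ (Ioo (0:ℝ) 1))
    (hg : ContinuousOn g {z : Fin 3 → ℝ | (∀ j : Fin 2, z (Fin.castSucc j) ∈ Set.Ioo (0:ℝ) 1) ∧
      z (Fin.last 2) ∈ Set.Ioo 0 z₁})
    (hle : ∀ z : Fin 3 → ℝ, z 0 ∈ Ioo (0:ℝ) 1 → z 1 ∈ Ioo (0:ℝ) 1 → z 2 ∈ Ioo 0 z₁ →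
      |g z| ≤ C * (φ (z 0) * φ (z 1) * ψ (z 2))) :
    IntegrableOn g {z : Fin 3 → ℝ | (∀ j : Fin 2, z (Fin.castSucc j) ∈ Set.Ioo (0:ℝ) 1) ∧
      z (Fin.last 2) ∈ Set.Ioo 0 z₁} := by
  -- the band is measurable
  have hBm : MeasurableSet {z : Fin 3 → ℝ | (∀ j : Fin 2, z (Fin.castSucc j) ∈ Set.Ioo (0:ℝ) 1) ∧
      z (Fin.last 2) ∈ Set.Ioo 0 z₁} := by
    rw [setOf_and, setOf_forall]
    exact (MeasurableSet.iInter fun j => measurable_pi_apply _ measurableSet_Ioo).inter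
      (measurable_pi_apply _ measurableSet_Ioo)
  -- the band lies in the open unit cube
  have hsub : {z : Fin 3 → ℝ | (∀ j : Fin 2, z (Fin.castSucc j) ∈ Set.Ioo (0:ℝ) 1) ∧
      z (Fin.last 2) ∈ Set.Ioo 0 z₁} ⊆ {z : Fin 3 → ℝ | ∀ j, z j ∈ Set.Ioo (0:ℝ) 1} := by
    rintro z ⟨h01, h2⟩ j
    exact Fin.lastCases (motive := fun j => z j ∈ Set.Ioo (0:ℝ) 1) ⟨h2.1, h2.2.trans_le hz1⟩
      (fun i => h01 i) j
  -- the majorant is integrable on the cube (Tonelli)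
  have hM : IntegrableOn (fun z : Fin 3 → ℝ => C * (φ (z 0) * φ (z 1) * ψ (z 2)))
      {z : Fin 3 → ℝ | ∀ j, z j ∈ Set.Ioo (0:ℝ) 1} := by
    rw [IntegrableOn, volume_restrict_setOf_forall_apply_mem_Ioo]
    refine Integrable.const_mul ?_ C
    have h := Integrable.fintype_prod (μ := fun _ : Fin 3 => (volume : Measure ℝ).restrict (Ioo 0 1))
      (f := ![φ, φ, ψ]) ?_
    · simpa only [Fin.prod_univ_three, Matrix.cons_val_zero, Matrix.cons_val_one, Matrix.head_cons,
        Matrix.cons_val_two, Matrix.tail_cons] using h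
    · intro i
      fin_cases i
      exacts [hφ, hφ, hψ]
  refine Integrable.mono' (hM.mono_set hsub) (hg.aestronglyMeasurable hBm) ?_
  refine ae_restrict_of_forall_mem hBm fun z hz => ?_
  rw [Real.norm_eq_abs]
  exact hle z (by simpa using hz.1 0) (by simpa using hz.1 1) (by simpa using hz.2)

/-! ## The stub -/

/-- absolute integrability of g₁ = ∂ₜP, g₂ = ∂ᵤQ on (0,1)²×(0,z₁): majorant C·z^{−a}(t-kernel)(u-kernel) from 1−(1−s)u ≥ s (num/elliott_certificate_hand.md) -/
theorem stub_elliottIntegrable :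
    ∀ (a c : ℚ) (z₁ : ℝ), 0 < a → a < 1 → 1 - a < c → 0 < z₁ → z₁ < 1 → IntegrableOn (fun z : Fin 3 → ℝ => ((z 0 ^ (-(a : ℝ)) * (1 - z 0) ^ ((c : ℝ) + (a : ℝ) - 2) * (1 - z 2 * z 0) ^ (-(a : ℝ)) * z 1 ^ (-(a : ℝ)) * (1 - z 1) ^ ((c : ℝ) + (a : ℝ) - 2) * (1 - (1 - z 2) * z 1) ^ (-(a : ℝ))) * z 1 * ((1 - 2 * z 0) - (a : ℝ) * (1 - z 0) - ((c : ℝ) + (a : ℝ) - 2) * z 0 + (a : ℝ) * z 2 * z 0 * (1 - z 0) / (1 - z 2 * z 0)))) {z : Fin 3 → ℝ | (∀ j : Fin 2, z (Fin.castSucc j) ∈ Set.Ioo (0:ℝ) 1) ∧ z (Fin.last 2) ∈ Set.Ioo 0 z₁} ∧ IntegrableOn (fun z : Fin 3 → ℝ => (-((z 0 ^ (-(a : ℝ)) * (1 - z 0) ^ ((c : ℝ) + (a : ℝ) - 2) * (1 - z 2 * z 0) ^ (-(a : ℝ)) * z 1 ^ (-(a : ℝ)) * (1 - z 1) ^ ((c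 : ℝ) + (a : ℝ) - 2) * (1 - (1 - z 2) * z 1) ^ (-(a : ℝ))) * z 0 * ((1 - 2 * z 1) - (a : ℝ) * (1 - z 1) - ((c : ℝ) + (a : ℝ) - 2) * z 1 + (a : ℝ) * (1 - z 2) * z 1 * (1 - z 1) / (1 - (1 - z 2) * z 1))))) {z : Fin 3 → ℝ | (∀ j : Fin 2, z (Fin.castSucc j) ∈ Set.Ioo (0:ℝ) 1) ∧ z (Fin.last 2) ∈ Set.Ioo 0 z₁} := by
  intro a c z₁ ha0 ha1 hac hz0 hz1
  have hα0 : (0:ℝ) < (a:ℝ) := by exact_mod_cast ha0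
  have hα1 : ((a:ℚ):ℝ) < 1 := by exact_mod_cast ha1
  have hγ : 1 - ((a:ℚ):ℝ) < ((c:ℚ):ℝ) := by exact_mod_cast hac
  -- the one-variable kernels
  have hφ : IntegrableOn (fun x : ℝ => x ^ (-(a:ℝ)) * (1 - x) ^ ((c:ℝ) + (a:ℝ) - 2)) (Ioo (0:ℝ) 1) := by
    have h := (Literature.Analysis.SpecialFunctions.Selberg.integrableOn_Ioo_rpow_mul_one_sub_rpow_and_integral_eq
      (a := 1 - (a:ℝ)) (b := (c:ℝ) + (a:ℝ) - 1) (by linarith) (by linarith)).1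
    have e1 : (1 - (a:ℝ)) - 1 = -(a:ℝ) := by ring
    have e2 : ((c:ℝ) + (a:ℝ) - 1) - 1 = (c:ℝ) + (a:ℝ) - 2 := by ring
    simpa only [e1, e2] using h
  have hψ : IntegrableOn (fun x : ℝ => x ^ (-(a:ℝ))) (Ioo (0:ℝ) 1) :=
    (intervalIntegral.integrableOn_Ioo_rpow_iff zero_lt_one).2 (by linarith)
  refine ⟨ellInt_integrableOn_band_of_abs_le ((2 + |(c:ℝ)| + 1 / (1 - z₁)) * (1 - z₁) ^ (-(a:ℝ)))
      hz1.le hφ hψ (ellInt_continuousOn_g₁ (a:ℝ) (c:ℝ) z₁ hz1)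
      (fun z ht hu hs => ellInt_abs_g₁_le hα0 hα1 hz1 ht hu hs),
    ellInt_integrableOn_band_of_abs_le ((2 + |(c:ℝ)| + 1 / (1 - z₁)) * (1 - z₁) ^ (-(a:ℝ)))
      hz1.le hφ hψ (ellInt_continuousOn_g₂ (a:ℝ) (c:ℝ) z₁ hz1)
      (fun z ht hu hs => ellInt_abs_g₂_le hα0 hα1 hz1 ht hu hs)⟩

/-- `stub_elliottIntegrable` under the registered stub name `stub_elliottIntegrableEL4` (identical statement:
absolute integrability of the Elliott divergence pieces g₁ = ∂ₜP, g₂ = ∂ᵤQ on the open band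
(0,1)²×(0,z₁); engine client E-L4). -/
theorem stub_elliottIntegrableEL4 :
    ∀ (a c : ℚ) (z₁ : ℝ), 0 < a → a < 1 → 1 - a < c → 0 < z₁ → z₁ < 1 → IntegrableOn (fun z : Fin 3 → ℝ => ((z 0 ^ (-(a : ℝ)) * (1 - z 0) ^ ((c : ℝ) + (a : ℝ) - 2) * (1 - z 2 * z 0) ^ (-(a : ℝ)) * z 1 ^ (-(a : ℝ)) * (1 - z 1) ^ ((c : ℝ) + (a : ℝ) - 2) * (1 - (1 - z 2) * z 1) ^ (-(a : ℝ))) * z 1 * ((1 - 2 * z 0) - (a : ℝ) * (1 - z 0) - ((c : ℝ) + (a : ℝ) - 2) * z 0 + (a : ℝ) * z 2 * z 0 * (1 - z 0) / (1 - z 2 * z 0)))) {z : Fin 3 → ℝ | (∀ j : Fin 2, z (Fin.castSucc j) ∈ Set.Ioo (0:ℝ) 1) ∧ z (Fin.last 2) ∈ Set.Ioo 0 z₁} ∧ IntegrableOn (fun z : Fin 3 → ℝ => (-((z 0 ^ (-(a : ℝ)) * (1 - z 0) ^ ((c : ℝ) + (a : ℝ) - 2) * (1 - z 2 * z 0) ^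 (-(a : ℝ)) * z 1 ^ (-(a : ℝ)) * (1 - z 1) ^ ((c : ℝ) + (a : ℝ) - 2) * (1 - (1 - z 2) * z 1) ^ (-(a : ℝ))) * z 0 * ((1 - 2 * z 1) - (a : ℝ) * (1 - z 1) - ((c : ℝ) + (a : ℝ) - 2) * z 1 + (a : ℝ) * (1 - z 2) * z 1 * (1 - z 1) / (1 - (1 - z 2) * z 1))))) {z : Fin 3 → ℝ | (∀ j : Fin 2, z (Fin.castSucc j) ∈ Set.Ioo (0:ℝ) 1) ∧ z (Fin.last 2) ∈ Set.Ioo 0 z₁} :=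
  stub_elliottIntegrable

end Summit.KontsevichZagierPeriods.KontsevichZagierPeriods.CompleteModGammaSectorEngine
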